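import Mathlib
import HarnessLib
import Summits.NavierStokesRegularity.NavierStokesRegularity.Theorems.LrcModEntire.Negative.ThickColumn
import Summits.NavierStokesRegularity.NavierStokesRegularity.Theorems.LrcModEntire.Negative.FalseWithoutMild

/-!
# Item `LrcModEntire` (stmt-NavierStokesRegularity-20428) — negative side: the THICK (NON-FROZEN) COLUMN, III: the
# window hypotheses of `stub_twistingThick` and the three germ alternatives

Negative-side support (refuter seat ns-regularity-refuter1; D-0081 §C), continuing `…Negative.ThickColumn`.  On the
window `thickWindow = {t < 0} × {0 < x₀ < π, 0 < x₁ < π, 0 < x₂ < 1/2}` the thick column profile satisfies EVERY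
window hypothesis of `stub_twistingThick` (twist-split v3): the three non-degeneracy pins, the time-only slope clause,
the non-vanishing twist bracket, and the THICK clause — for every `m : ℝ → ℝ → ℝ` and every non-empty `W₁ ⊆ thickWindow`
some (indeed every) point of `W₁` violates `∂₂ v_b = m(t, x₂) ∂_b v₂` for `b = 0` or `b = 1` (`thickProfile_no_slope`:
the two modes have slopes `−1 ≠ −4`).  Every slice, its vorticity and the vorticity's directional derivatives are
entire real-analytic, and (identity theorem `…GermOffFourStrata.eq_zero_of_eqOn_open`) no non-empty open set of any
slice `s < 0` carries a vorticity TRANSLATION germ (evaluate at `0`, `e₂/4`, `(π/2)e₁ + e₂/4`), a vertical-axis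
ROTATION germ (Killing defect at `(π/2, π/2, 0)`), or an UNBOUNDED ENTIRE germ (`‖v(s)‖ ≤ 10(−s)^{-1/2}`).
WHAT THIS IS NOT: not a claim about Navier–Stokes regularity — elementary analysis of a kinematic witness. [folklore]
-/

noncomputable section

-- the summit and its single sub-problem share the name (CONVENTIONS §1), as in every Theorems file
set_option linter.dupNamespace false

namespace Summit.NavierStokesRegularity.NavierStokesRegularity.Theorems.LrcModEntire.Negative

open MeasureTheory Set Function Filter Topology Metric
open scoped RealInnerProductSpace InnerProductSpace
open Literature.Analysis Literature.Analysis.FluidPDE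
open Summit.NavierStokesRegularity.NavierStokesRegularity.Theorems.PoloidalWindowRigidity.Negative

local notation "E3" => EuclideanSpace ℝ (Fin 3)
local notation "π" i => (EuclideanSpace.proj (𝕜 := ℝ) (i : Fin 3) : EuclideanSpace ℝ (Fin 3) →L[ℝ] ℝ)
local notation "𝐞" i => (EuclideanSpace.single (i : Fin 3) (1 : ℝ) : EuclideanSpace ℝ (Fin 3))

/-! ## The window -/

/-- The window is open. [folklore] -/
theorem isOpen_thickWindow : IsOpen thickWindow := by
  refine isOpen_Iio.prod ?_
  have h0 : Continuous fun x : E3 => x 0 := by fun_prop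
  have h1 : Continuous fun x : E3 => x 1 := by fun_prop
  have h2 : Continuous fun x : E3 => x 2 := by fun_prop
  exact (isOpen_lt continuous_const h0).inter ((isOpen_lt h0 continuous_const).inter
    ((isOpen_lt continuous_const h1).inter ((isOpen_lt h1 continuous_const).inter
      ((isOpen_lt continuous_const h2).inter (isOpen_lt h2 continuous_const)))))

/-- The window is non-empty: it contains `(−1, (π/2, π/2, 1/4))`. [folklore] -/
theorem thickWindow_nonempty : thickWindow.Nonempty := by
  have hpi := Real.pi_gt_three
  refine ⟨((-1 : ℝ), (Real.pi / 2) • (𝐞 0) + (Real.pi / 2) • (𝐞 1) + (1 / 4 : ℝ) • (𝐞 2)), ?_, ?_⟩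
  · show (-1 : ℝ) < 0
    norm_num
  · have a0 : ((Real.pi / 2) • (𝐞 0) + (Real.pi / 2) • (𝐞 1) + (1 / 4 : ℝ) • (𝐞 2) : E3) 0 = Real.pi / 2 := by simp
    have a1 : ((Real.pi / 2) • (𝐞 0) + (Real.pi / 2) • (𝐞 1) + (1 / 4 : ℝ) • (𝐞 2) : E3) 1 = Real.pi / 2 := by simp
    have a2 : ((Real.pi / 2) • (𝐞 0) + (Real.pi / 2) • (𝐞 1) + (1 / 4 : ℝ) • (𝐞 2) : E3) 2 = 1 / 4 := by simp
    show 0 < ((Real.pi / 2) • (𝐞 0) + (Real.pi / 2) • (𝐞 1) + (1 / 4 : ℝ) • (𝐞 2) : E3) 0 ∧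
      ((Real.pi / 2) • (𝐞 0) + (Real.pi / 2) • (𝐞 1) + (1 / 4 : ℝ) • (𝐞 2) : E3) 0 < Real.pi ∧
      0 < ((Real.pi / 2) • (𝐞 0) + (Real.pi / 2) • (𝐞 1) + (1 / 4 : ℝ) • (𝐞 2) : E3) 1 ∧
      ((Real.pi / 2) • (𝐞 0) + (Real.pi / 2) • (𝐞 1) + (1 / 4 : ℝ) • (𝐞 2) : E3) 1 < Real.pi ∧
      0 < ((Real.pi / 2) • (𝐞 0) + (Real.pi / 2) • (𝐞 1) + (1 / 4 : ℝ) • (𝐞 2) : E3) 2 ∧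
      ((Real.pi / 2) • (𝐞 0) + (Real.pi / 2) • (𝐞 1) + (1 / 4 : ℝ) • (𝐞 2) : E3) 2 < 1 / 2
    rw [a0, a1, a2]
    refine ⟨by linarith, by linarith, by linarith, by linarith, by norm_num, by norm_num⟩

/-- The window lies in the open backward slab. [folklore] -/
theorem thickWindow_subset : thickWindow ⊆ Set.Iio (0 : ℝ) ×ˢ Set.univ :=
  Set.prod_mono le_rfl (Set.subset_univ _)

/-- Membership in the window, unfolded. [folklore] -/
theorem mem_thickWindow {z : ℝ × E3} (hz : z ∈ thickWindow) :
    z.1 < 0 ∧ 0 < z.2 0 ∧ z.2 0 < Real.pi ∧ 0 < z.2 1 ∧ z.2 1 < Real.pi ∧ 0 < z.2 2 ∧ z.2 2 < 1 / 2 := by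
  simpa [thickWindow, Set.mem_prod] using hz

/-! ## The pins, the two slope clauses and the twist on the window -/

/-- **The three non-degeneracy pins hold on the window**: `curl v ≠ 0`, `∂₀ v₂ ≠ 0`, `∂₂ v₀ ≠ 0`. [folklore] -/
theorem thickProfile_pins (z : ℝ × E3) (hz : z ∈ thickWindow) :
    curl (thickProfile z.1) z.2 ≠ 0 ∧
      (fderiv ℝ (thickProfile z.1) z.2 (𝐞 0) 2 ≠ 0 ∨ fderiv ℝ (thickProfile z.1) z.2 (𝐞 1) 2 ≠ 0) ∧
      (fderiv ℝ (thickProfile z.1) z.2 (𝐞 2) 0 ≠ 0 ∨ fderiv ℝ (thickProfile z.1) z.2 (𝐞 2) 1 ≠ 0) := by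
  obtain ⟨ht, hx0, hx0', -, -, hx2, hx2'⟩ := mem_thickWindow hz
  have hc := cellAmp_pos ht
  have hs0 : 0 < Real.sin (z.2 0) := Real.sin_pos_of_pos_of_lt_pi hx0 hx0'
  have hP := thickP_pos hx2 hx2'
  have hPs := mul_pos hc (mul_pos hP hs0)
  refine ⟨fun h0 => ?_, Or.inl ?_, Or.inl ?_⟩
  · have h1 := curl_thickProfile_apply_one z.1 z.2
    rw [h0, PiLp.zero_apply] at h1
    have h2 : 0 < cellAmp z.1 * (2 * thickP (z.2 2) * Real.sin (z.2 0)) := by nlinarith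
    linarith
  · rw [fderiv_thickProfile_e0_apply_two, mul_neg]
    exact (neg_neg_of_pos hPs).ne
  · rw [fderiv_thickProfile_e2_apply_zero]
    exact hPs.ne'

/-- **The time-only slope clause holds on the window** (indeed at every point of every `W₁ ⊆ thickWindow`). [folklore] -/
theorem thickProfile_slope_clause_time (m : ℝ → ℝ) (W₁ : Set (ℝ × E3)) (hW₁ : W₁ ⊆ thickWindow)
    (hne : W₁.Nonempty) :
    ∃ z ∈ W₁, ∃ b : Fin 3, b ≠ 2 ∧
      fderiv ℝ (thickProfile z.1) z.2 (𝐞 2) b ≠ m z.1 * fderiv ℝ (thickProfile z.1) z.2 (𝐞 b) 2 := by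
  obtain ⟨z, hz⟩ := hne
  obtain ⟨ht, hx0, hx0', hx1, hx1', hx2, hx2'⟩ := mem_thickWindow (hW₁ hz)
  have hs0 := Real.sin_pos_of_pos_of_lt_pi hx0 hx0'
  have hs1 := Real.sin_pos_of_pos_of_lt_pi hx1 hx1'
  by_cases h0 : fderiv ℝ (thickProfile z.1) z.2 (𝐞 2) 0 = m z.1 * fderiv ℝ (thickProfile z.1) z.2 (𝐞 0) 2
  · exact ⟨z, hz, 1, by decide, fun h1 =>
      thickProfile_no_slope ht hs0 hs1 (thickP_pos hx2 hx2') (thickQ_pos hx2 hx2') (m z.1) h0 h1⟩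
  · exact ⟨z, hz, 0, by decide, h0⟩

/-- **The THICK clause holds on the window**: for every time–height slope candidate `m : ℝ → ℝ → ℝ` and every
non-empty `W₁ ⊆ thickWindow`, some (indeed every) point of `W₁` violates `∂₂ v_b = m(t, x₂) ∂_b v₂` for `b = 0` or
`b = 1` — the slope is a function of `(t, x₂)` on NO open subset. [folklore] -/
theorem thickProfile_slope_clause_timeHeight (m : ℝ → ℝ → ℝ) (W₁ : Set (ℝ × E3)) (hW₁ : W₁ ⊆ thickWindow)
    (hne : W₁.Nonempty) :
    ∃ z ∈ W₁, ∃ b : Fin 3, b ≠ 2 ∧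
      fderiv ℝ (thickProfile z.1) z.2 (𝐞 2) b ≠ m z.1 (z.2 2) * fderiv ℝ (thickProfile z.1) z.2 (𝐞 b) 2 := by
  obtain ⟨z, hz⟩ := hne
  obtain ⟨ht, hx0, hx0', hx1, hx1', hx2, hx2'⟩ := mem_thickWindow (hW₁ hz)
  have hs0 := Real.sin_pos_of_pos_of_lt_pi hx0 hx0'
  have hs1 := Real.sin_pos_of_pos_of_lt_pi hx1 hx1'
  by_cases h0 : fderiv ℝ (thickProfile z.1) z.2 (𝐞 2) 0 = m z.1 (z.2 2) * fderiv ℝ (thickProfile z.1) z.2 (𝐞 0) 2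
  · exact ⟨z, hz, 1, by decide, fun h1 =>
      thickProfile_no_slope ht hs0 hs1 (thickP_pos hx2 hx2') (thickQ_pos hx2 hx2') (m z.1 (z.2 2)) h0 h1⟩
  · exact ⟨z, hz, 0, by decide, h0⟩

/-- **The twist bracket is non-zero on the window** (`= (−t)^{-1} sin x₀ sin x₁ · sin x₂ (2cos² x₂ + 1) > 0`). [folklore] -/
theorem thickProfile_twist_ne_zero (z : ℝ × E3) (hz : z ∈ thickWindow) :
    fderiv ℝ (fun x => fderiv ℝ (thickProfile z.1) x (𝐞 2) 2) z.2 (𝐞 0) *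
          fderiv ℝ (thickProfile z.1) z.2 (𝐞 1) 2 -
        fderiv ℝ (fun x => fderiv ℝ (thickProfile z.1) x (𝐞 2) 2) z.2 (𝐞 1) *
          fderiv ℝ (thickProfile z.1) z.2 (𝐞 0) 2 ≠ 0 := by
  rw [thickProfile_twist]
  obtain ⟨ht, hx0, hx0', hx1, hx1', hx2, hx2'⟩ := mem_thickWindow hz
  exact (mul_pos (mul_pos (pow_pos (cellAmp_pos ht) 2)
    (mul_pos (Real.sin_pos_of_pos_of_lt_pi hx0 hx0') (Real.sin_pos_of_pos_of_lt_pi hx1 hx1')))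
    (thickWronskian_pos hx2 hx2')).ne'

/-! ## Real-analyticity of the slices, of their vorticity and of its derivatives -/

/-- The profile slice in the standard basis. [folklore] -/
theorem thickProfile_eq_sum (s : ℝ) (x : E3) : thickProfile s x =
    (cellAmp s * -(thickP₁ (x 2) * Real.sin (x 0))) • (𝐞 0) +
      (cellAmp s * -(thickQ₁ (x 2) * Real.sin (x 1))) • (𝐞 1) +
      (cellAmp s * (thickP (x 2) * Real.cos (x 0) + thickQ (x 2) * Real.cos (x 1))) • (𝐞 2) := by
  ext i
  fin_cases i <;> simp [thickProfile, thickField_apply_zero, thickField_apply_one, thickField_apply_two]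

/-- **Every slice of the thick column profile is real-analytic on `ℝ³`.** [folklore] -/
theorem analyticOnNhd_thickProfile (s : ℝ) : AnalyticOnNhd ℝ (thickProfile s) univ := by
  intro x _
  have hY := fun k => analyticAt_coord k x
  have hP1 : AnalyticAt ℝ (fun y : E3 => thickP₁ (y 2)) x := ((analyticAt_thickP₁ _).comp (hY 2) :)
  have hQ1 : AnalyticAt ℝ (fun y : E3 => thickQ₁ (y 2)) x := ((analyticAt_thickQ₁ _).comp (hY 2) :)
  have hP : AnalyticAt ℝ (fun y : E3 => thickP (y 2)) x := ((analyticAt_thickP _).comp (hY 2) :)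
  have hQ : AnalyticAt ℝ (fun y : E3 => thickQ (y 2)) x := ((analyticAt_thickQ _).comp (hY 2) :)
  have hs0 : AnalyticAt ℝ (fun y : E3 => Real.sin (y 0)) x := (Real.analyticAt_sin.comp (hY 0) :)
  have hs1 : AnalyticAt ℝ (fun y : E3 => Real.sin (y 1)) x := (Real.analyticAt_sin.comp (hY 1) :)
  have hc0 : AnalyticAt ℝ (fun y : E3 => Real.cos (y 0)) x := (Real.analyticAt_cos.comp (hY 0) :)
  have hc1 : AnalyticAt ℝ (fun y : E3 => Real.cos (y 1)) x := (Real.analyticAt_cos.comp (hY 1) :)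
  have e : thickProfile s = fun x =>
      (cellAmp s * -(thickP₁ (x 2) * Real.sin (x 0))) • (𝐞 0) +
        (cellAmp s * -(thickQ₁ (x 2) * Real.sin (x 1))) • (𝐞 1) +
        (cellAmp s * (thickP (x 2) * Real.cos (x 0) + thickQ (x 2) * Real.cos (x 1))) • (𝐞 2) :=
    funext (thickProfile_eq_sum s)
  rw [e]
  exact (((analyticAt_const.mul (hP1.mul hs0).neg).smul analyticAt_const).add
    ((analyticAt_const.mul (hQ1.mul hs1).neg).smul analyticAt_const)).add
    ((analyticAt_const.mul ((hP.mul hc0).add (hQ.mul hc1))).smul analyticAt_const)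

/-- **The vorticity of every slice is real-analytic on `ℝ³`.** [folklore] -/
theorem analyticOnNhd_curl_thickProfile (s : ℝ) : AnalyticOnNhd ℝ (curl (thickProfile s)) univ := by
  intro x _
  have hY := fun k => analyticAt_coord k x
  have hP : AnalyticAt ℝ (fun y : E3 => thickP (y 2)) x := ((analyticAt_thickP _).comp (hY 2) :)
  have hQ : AnalyticAt ℝ (fun y : E3 => thickQ (y 2)) x := ((analyticAt_thickQ _).comp (hY 2) :)
  have hs0 : AnalyticAt ℝ (fun y : E3 => Real.sin (y 0)) x := (Real.analyticAt_sin.comp (hY 0) :)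
  have hs1 : AnalyticAt ℝ (fun y : E3 => Real.sin (y 1)) x := (Real.analyticAt_sin.comp (hY 1) :)
  have e : curl (thickProfile s) = fun x =>
      (cellAmp s * -(5 * thickQ (x 2) * Real.sin (x 1))) • (𝐞 0) +
        (cellAmp s * (2 * thickP (x 2) * Real.sin (x 0))) • (𝐞 1) := by
    funext x
    rw [curl_thickProfile, thickVort, smul_add, smul_smul, smul_smul]
  rw [e]
  exact ((analyticAt_const.mul ((analyticAt_const.mul hQ).mul hs1).neg).smul analyticAt_const).add
    ((analyticAt_const.mul ((analyticAt_const.mul hP).mul hs0)).smul analyticAt_const)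

/-- **Every directional derivative of the vorticity of every slice is real-analytic on `ℝ³`.** [folklore] -/
theorem analyticOnNhd_fderiv_curl_thickProfile_apply (s : ℝ) (e : E3) :
    AnalyticOnNhd ℝ (fun y => fderiv ℝ (curl (thickProfile s)) y e) univ :=
  (ContinuousLinearMap.apply ℝ (EuclideanSpace ℝ (Fin 3)) e).comp_analyticOnNhd
    (analyticOnNhd_curl_thickProfile s).fderiv

/-! ## No window of any slice carries a Killing germ or an unbounded entire germ -/

/-- `Q₁(1/4) ≠ 0`. [folklore] -/
theorem thickQ₁_quarter_ne_zero : thickQ₁ (1 / 4) ≠ 0 := by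
  rw [thickQ₁, neg_ne_zero]
  exact mul_ne_zero two_ne_zero
    (Real.sin_pos_of_pos_of_lt_pi (by norm_num) (by linarith [Real.pi_gt_three])).ne'

/-- **No translation germ**: on no non-empty open set of any slice `s < 0` does a directional derivative of the
vorticity in a fixed non-zero direction vanish (evaluate the entire extension at `0`, `e₂/4`, `(π/2)e₁ + e₂/4`).
[folklore] -/
theorem thickProfile_no_translation_germ {s : ℝ} (hs : s < 0) {U : Set E3} (hU : IsOpen U) (hne : U.Nonempty)
    {e : E3} (he : e ≠ 0) (h : ∀ y ∈ U, fderiv ℝ (curl (thickProfile s)) y e = 0) : False := by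
  obtain ⟨y₀, hy₀⟩ := hne
  have hglob := eq_zero_of_eqOn_open (analyticOnNhd_fderiv_curl_thickProfile_apply s e) hU hy₀ h
  have hc := cellAmp_pos hs
  have hQ : 0 < thickQ (1 / 4) := thickQ_pos (by norm_num) (by norm_num)
  have q0 : (((1 / 4 : ℝ)) • (𝐞 2) : E3) 0 = 0 := by simp
  have q1 : (((1 / 4 : ℝ)) • (𝐞 2) : E3) 1 = 0 := by simp
  have q2 : (((1 / 4 : ℝ)) • (𝐞 2) : E3) 2 = 1 / 4 := by simp
  have p1 : ((Real.pi / 2) • (𝐞 1) + (1 / 4 : ℝ) • (𝐞 2) : E3) 1 = Real.pi / 2 := by simp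
  have p2 : ((Real.pi / 2) • (𝐞 1) + (1 / 4 : ℝ) • (𝐞 2) : E3) 2 = 1 / 4 := by simp
  -- at `y = 0`, second component: `2 (−s)^{-1/2} P(0) e₀ = 0`
  have h0' : e 0 = 0 := by
    have h0 : fderiv ℝ (curl (thickProfile s)) 0 e 1 = 0 := by rw [hglob 0, PiLp.zero_apply]
    rw [fderiv_curl_thickProfile_apply_one, PiLp.zero_apply, PiLp.zero_apply, Real.sin_zero, Real.cos_zero,
      thickP_zero] at h0
    have : cellAmp s * e 0 = 0 := by linear_combination (1 / 2 : ℝ) * h0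
    rcases mul_eq_zero.1 this with h' | h'
    · exact absurd h' hc.ne'
    · exact h'
  -- at `y = e₂/4`, first component: `−5 (−s)^{-1/2} Q(1/4) e₁ = 0`
  have h1 : e 1 = 0 := by
    have h0 : fderiv ℝ (curl (thickProfile s)) ((1 / 4 : ℝ) • (𝐞 2)) e 0 = 0 := by
      rw [hglob _, PiLp.zero_apply]
    rw [fderiv_curl_thickProfile_apply_zero, q1, q2, Real.sin_zero, Real.cos_zero] at h0
    have : cellAmp s * thickQ (1 / 4) * e 1 = 0 := by linear_combination -(1 / 5 : ℝ) * h0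
    rcases mul_eq_zero.1 this with h' | h'
    · rcases mul_eq_zero.1 h' with h'' | h''
      · exact absurd h'' hc.ne'
      · exact absurd h'' hQ.ne'
    · exact h'
  -- at `y = (π/2)e₁ + e₂/4`, first component: `−5 (−s)^{-1/2} Q₁(1/4) e₂ = 0`
  have h2 : e 2 = 0 := by
    have h0 : fderiv ℝ (curl (thickProfile s)) ((Real.pi / 2) • (𝐞 1) + (1 / 4 : ℝ) • (𝐞 2)) e 0 = 0 := by
      rw [hglob _, PiLp.zero_apply]
    rw [fderiv_curl_thickProfile_apply_zero, p1, p2, Real.sin_pi_div_two, Real.cos_pi_div_two] at h0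
    have : cellAmp s * thickQ₁ (1 / 4) * e 2 = 0 := by linear_combination -(1 / 5 : ℝ) * h0
    rcases mul_eq_zero.1 this with h' | h'
    · rcases mul_eq_zero.1 h' with h'' | h''
      · exact absurd h'' hc.ne'
      · exact absurd h'' thickQ₁_quarter_ne_zero
    · exact h'
  apply he
  ext i
  fin_cases i
  · simpa using h0'
  · simpa using h1
  · simpa using h2

/-- **No rotation germ about a vertical axis**: on no non-empty open set of any slice `s < 0` does the vorticity
satisfy the infinitesimal Killing equation `J curl v(s)(y) = D(curl v(s))(y) J(y − c)` of the rotations about the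
vertical axis through `c` (first component of the entire Killing defect at `(π/2, π/2, 0)`: `−2(−s)^{-1/2} = 0`).
[folklore] -/
theorem thickProfile_no_rotation_germ {s : ℝ} (hs : s < 0) {U : Set E3} (hU : IsOpen U) (hne : U.Nonempty)
    (c : E3) (h : ∀ y ∈ U, rotGen (curl (thickProfile s) y) = fderiv ℝ (curl (thickProfile s)) y (rotGen (y - c))) :
    False := by
  obtain ⟨y₀, hy₀⟩ := hne
  have hc := cellAmp_pos hs
  -- the first component of the Killing defect, written out: an entire function
  set φ : E3 → ℝ := fun y =>
    cellAmp s * (2 * thickP (y 2) * Real.sin (y 0)) -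
      cellAmp s * ((5 * thickQ (y 2)) * (Real.cos (y 1) * (y 0 - c 0))) with hφ
  have hφa : AnalyticOnNhd ℝ φ univ := by
    intro y _
    have hY := fun k => analyticAt_coord k y
    have hP : AnalyticAt ℝ (fun y : E3 => thickP (y 2)) y := ((analyticAt_thickP _).comp (hY 2) :)
    have hQ : AnalyticAt ℝ (fun y : E3 => thickQ (y 2)) y := ((analyticAt_thickQ _).comp (hY 2) :)
    exact (analyticAt_const.mul ((analyticAt_const.mul hP).mul (Real.analyticAt_sin.comp (hY 0)))).sub
      (analyticAt_const.mul ((analyticAt_const.mul hQ).mul ((Real.analyticAt_cos.comp (hY 1)).mul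
        ((hY 0).sub analyticAt_const))))
  have hφU : ∀ y ∈ U, φ y = 0 := fun y hy => by
    have hy' := congrArg (fun w : E3 => w 0) (h y hy)
    dsimp only at hy'
    rw [rotGen_apply_zero, curl_thickProfile_apply_one, fderiv_curl_thickProfile_apply_zero, rotGen_apply_one,
      rotGen_apply_two, PiLp.sub_apply] at hy'
    rw [hφ]
    linear_combination -hy'
  have p0 : ((Real.pi / 2) • (𝐞 0) + (Real.pi / 2) • (𝐞 1) : E3) 0 = Real.pi / 2 := by simp
  have p1 : ((Real.pi / 2) • (𝐞 0) + (Real.pi / 2) • (𝐞 1) : E3) 1 = Real.pi / 2 := by simp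
  have p2 : ((Real.pi / 2) • (𝐞 0) + (Real.pi / 2) • (𝐞 1) : E3) 2 = 0 := by simp
  have h0 := eq_zero_of_eqOn_open hφa hU hy₀ hφU ((Real.pi / 2) • (𝐞 0) + (Real.pi / 2) • (𝐞 1))
  rw [hφ] at h0
  dsimp only at h0
  rw [p0, p1, p2, Real.sin_pi_div_two, Real.cos_pi_div_two, thickP_zero] at h0
  have : cellAmp s = 0 := by linear_combination (1 / 2 : ℝ) * h0
  exact hc.ne' this

/-- **No unbounded entire germ**: an entire real-analytic field agreeing with a slice of the witness on a non-empty
open set is the slice itself, hence bounded (`‖v(s)‖ ≤ 10 (−s)^{-1/2}`). [folklore] -/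
theorem thickProfile_no_unbounded_entire_germ (s : ℝ) {U : Set E3} (hU : IsOpen U) (hne : U.Nonempty)
    {w : E3 → E3} (hw : AnalyticOnNhd ℝ w univ) (hwU : ∀ y ∈ U, thickProfile s y = w y) :
    BddAbove (Set.range fun y => ‖w y‖) := by
  obtain ⟨y₀, hy₀⟩ := hne
  have hglob := eq_zero_of_eqOn_open (hw.sub (analyticOnNhd_thickProfile s)) hU hy₀
    (fun y hy => by simp [hwU y hy])
  refine ⟨cellAmp s * 10, ?_⟩
  rintro _ ⟨y, rfl⟩
  have hy : w y = thickProfile s y := by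
    have h := hglob y
    simp only [Pi.sub_apply, sub_eq_zero] at h
    exact h
  show ‖w y‖ ≤ cellAmp s * 10
  rw [hy]
  exact norm_thickProfile_le s y

end Summit.NavierStokesRegularity.NavierStokesRegularity.Theorems.LrcModEntire.Negative

end
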